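import Literature.AlgebraicGeometry.Modules.PullbackPushforwardDescentChart
import Literature.AlgebraicGeometry.Modules.PullbackPushforwardGaloisChartBasicOpen
import Literature.AlgebraicGeometry.Modules.IsoOfSectionsOnBasis
import Literature.AlgebraicGeometry.Modules.LocallyFreeTrace
import HarnessLib

/-!
# The descent identity `(f_*f^*M)^K ≅ M`: invariant sections of `f_*f^*M` are uniquely pulled back from `M`

Mumford, *Abelian Varieties* (1970), §7 Thm. 4 (p. 72) ∕ §12 Thm. 1 (p. 111): along a free quotient `π : X → Y = X∕G` by a finite group,
`π^*` is an equivalence between `𝒪_Y`-modules and `G`-sheaves on `X`; in particular the `G`-invariants of `π_*π^*M` are `M`. This file proves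
the invariants statement in the generality of `Modules/PullbackPushforwardGaloisChart`: `f : X → Y` AFFINE, self-maps `τ : K → (X ⟶ X)` over
`Y` with `K` FINITE acting on `f_*f^*M` by `act_x` (`Modules/PullbackPushforwardGroupAction`), `M` FINITE LOCALLY FREE, every point of `Y`
having an affine neighbourhood `V` on which the invariant functions of `f⁻¹V` descend (`ChartInvariants`, Chase–Harrison–Rosenberg), and
`f♯` injective on affine opens:

* `pullbackUnit_app_injective` — `η_M : Γ(W, M) → Γ(W, f_*f^*M)` is injective over every open `W` (framed affine opens form a basis;
  `Modules/PullbackPushforwardDescentChart.unitSection_injective_of_frame`; `Modules/IsoOfSectionsOnBasis`);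
* `twistAction_app_map` — `act_x` commutes with restriction;
* **`existsUnique_pullbackUnit_app_eq_of_twistAction_invariant`** — over every open `W`, a section of `f_*f^*M` fixed by all `act_x` is
  `η(m)` for a UNIQUE `m ∈ Γ(W, M)`: the framed Galois PRINCIPAL opens cover `W` (`Modules/PullbackPushforwardGaloisChartBasicOpen`),
  on each the section descends (`…DescentChart.exists_unitSection_eq_of_twistAction_invariant`), the local descents agree by injectivity of
  `η`, and glue in the sheaf `M` (Mathlib `TopCat.Sheaf.existsUnique_gluing'`).

Everything is proved; no named facts, no `sorry`. Written for Hodge road №4 (crux stmt-HodgeConjecture-26512, lens line N′: the descent-identity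
face «`(q_*q^*M)^Ḡ ≅ M`» of the object residue (N-U); director-hodge (M5)-lite); the instance for the quotient isogeny `q : J × Ĵ → Y` is the
Theorems-lane sequel.

## References

* D. Mumford, *Abelian Varieties* (1970), §7 Thm. 4 (p. 72), §12 Thm. 1 (p. 111). [MumfordAV1970]
* C. Greither, *Cyclic Galois extensions of commutative rings*, LNM 1534 (1992), Ch. 0 §1. [Greither1992CyclicGalois]
* The Stacks Project, Tag 009U (sheaves and morphisms on a basis; gluing). [StacksProject]
-/

noncomputable section

-- `TopCat.Presheaf`/`Scheme.Modules` are not reducible (as in Mathlib's `AlgebraicGeometry/Modules/Sheaf.lean`).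
set_option backward.isDefEq.respectTransparency false

open CategoryTheory AlgebraicGeometry TopologicalSpace Opposite
open AlgebraicGeometry.Scheme.Modules

universe u

namespace Literature.AlgebraicGeometry.Modules

open Literature.AlgebraicGeometry.Motives

variable {X Y : Scheme.{u}} (f : X ⟶ Y) {K : Type u} (τ : K → (X ⟶ X)) (hτ : ∀ x, τ x ≫ f = f)
  (M : Y.Modules)

/-- **`η_M : M → f_*f^*M` is injective on sections over EVERY open** when `M` is finite locally free and `f♯` is injective on the affine opens
(injective on the framed affine opens by `unitSection_injective_of_frame`, which form a basis). [cite: MumfordAV1970, §7 Thm. 4 (p. 72)] -/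
theorem pullbackUnit_app_injective (hfree : IsFiniteLocallyFree M)
    (hinj : ∀ ⦃V : Y.Opens⦄, IsAffineOpen V → Function.Injective (f.app V)) (W : Y.Opens) :
    Function.Injective ((pullbackUnit f M).app W) := by
  classical
  -- the basis of affine opens lying in a trivialising open of `M`
  let B : Set Y.Opens := {V | IsAffineOpen V ∧ ∃ y : Y, V ≤ trivNbhd hfree y}
  have hB : Opens.IsBasis B := by
    rw [Opens.isBasis_iff_nbhd]
    intro U y hy
    obtain ⟨_, ⟨V, hV, rfl⟩, hyV, hVle⟩ := Y.isBasis_affineOpens.exists_subset_of_mem_open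
      (show y ∈ U ⊓ trivNbhd hfree y from ⟨hy, mem_trivNbhd hfree y⟩) (U ⊓ trivNbhd hfree y).2
    exact ⟨V, ⟨hV, y, fun z hz => (hVle hz).2⟩, hyV, fun z hz => (hVle hz).1⟩
  refine app_injective_of_injective_on_basis (pullbackUnit f M) hB (fun V hV => ?_) W
  obtain ⟨hVa, y, hVy⟩ := hV
  haveI : Fintype (TrivIndex hfree y) := inferInstance
  exact unitSection_injective_of_frame f M
    (Literature.AlgebraicGeometry.Motives.SheafOfModules.restrictTrivialisation (R := Y.ringCatSheaf) (homOfLE hVy) (trivFrame hfree y))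
    (hinj hVa)

/-- The action commutes with restriction (naturality of the module morphism `act_x`). [cite: MumfordAV1970, §7 Thm. 4 (p. 72)] -/
theorem twistAction_app_map {W W' : Y.Opens} (k : W' ⟶ W) (x : K) (s : Γ((pushforward f).obj ((pullback f).obj M), W)) :
    (twistAction f τ hτ M x).app W' (((pushforward f).obj ((pullback f).obj M)).presheaf.map k.op s) =
      ((pushforward f).obj ((pullback f).obj M)).presheaf.map k.op ((twistAction f τ hτ M x).app W s) :=
  app_presheaf_map (twistAction f τ hτ M x) k s

/-- **THE DESCENT IDENTITY `(f_*f^*M)^K = η(M) ≅ M`** (Mumford §7 Thm. 4 ∕ §12 Thm. 1 for the modules `f^*M`): let `f` be affine, `K` finite,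
`M` finite locally free, every point of `Y` have an affine neighbourhood on which the `K`-invariant functions of `f⁻¹V` descend
(`ChartInvariants`), and `f♯` be injective on affine opens. Then over EVERY open `W ⊆ Y`, a section of `f_*f^*M` fixed by all `act_x` is
`η(m)` for a UNIQUE `m ∈ Γ(W, M)`. (Local existence on the framed Galois principal opens — a basis by `chartInvariants_basicOpen` — then
gluing in the sheaf `M` along the injectivity of `η`.) [cite: MumfordAV1970, §7 Thm. 4 (p. 72) and §12 Thm. 1 (p. 111)] -/
theorem existsUnique_pullbackUnit_app_eq_of_twistAction_invariant [Finite K] [IsAffineHom f] (hfree : IsFiniteLocallyFree M)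
    (hchart : ∀ y : Y, ∃ V : Y.Opens, y ∈ V ∧ IsAffineOpen V ∧ ChartInvariants f τ hτ V)
    (hinj : ∀ ⦃V : Y.Opens⦄, IsAffineOpen V → Function.Injective (f.app V))
    (W : Y.Opens) (s : Γ((pushforward f).obj ((pullback f).obj M), W))
    (hs : ∀ x, (twistAction f τ hτ M x).app W s = s) :
    ∃! m : Γ(M, W), (pullbackUnit f M).app W m = s := by
  classical
  refine existsUnique_of_exists_of_unique ?_ fun m m' hm hm' =>
    pullbackUnit_app_injective f M hfree hinj W (hm.trans hm'.symm)
  -- the cover of `W` by framed Galois principal opens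
  let J := Σ' (V : Y.Opens) (_ : V ≤ W) (_ : ChartInvariants f τ hτ V) (y : Y), V ≤ trivNbhd hfree y
  let C : J → Y.Opens := fun j => j.1
  have hcov : W ≤ iSup C := fun y hy => by
    obtain ⟨V₀, hyV₀, hV₀, hinv₀⟩ := hchart y
    obtain ⟨r, hrle, hyr⟩ := hV₀.exists_basicOpen_le
      (⟨y, (⟨hy, mem_trivNbhd hfree y⟩ : y ∈ W ⊓ trivNbhd hfree y)⟩ : ↥(W ⊓ trivNbhd hfree y)) hyV₀
    exact Opens.mem_iSup.mpr ⟨⟨Y.basicOpen r, fun z hz => (hrle hz).1, chartInvariants_basicOpen f τ hτ hV₀ hinv₀ r, y,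
      fun z hz => (hrle hz).2⟩, hyr⟩
  -- local descents
  have hloc : ∀ j : J, ∃ m : Γ(M, C j), unitSection f M (C j) m =
      ((pushforward f).obj ((pullback f).obj M)).presheaf.map (homOfLE j.2.1).op s := fun j => by
    obtain ⟨V, hVW, hinvV, y, hVy⟩ := j
    haveI : Fintype (TrivIndex hfree y) := inferInstance
    exact exists_unitSection_eq_of_twistAction_invariant f τ hτ M
      (Literature.AlgebraicGeometry.Motives.SheafOfModules.restrictTrivialisation (R := Y.ringCatSheaf) (homOfLE hVy) (trivFrame hfree y))
      hinvV _ fun x => by rw [twistAction_app_map, hs x]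
  choose m hm using hloc
  -- compatibility on overlaps, by injectivity of `η`
  have hcompat : TopCat.Presheaf.IsCompatible (⟨M.presheaf, M.isSheaf⟩ : TopCat.Sheaf Ab Y).1 C m := fun i j => by
    apply pullbackUnit_app_injective f M hfree hinj
    change unitSection f M _ (M.presheaf.map _ (m i)) = unitSection f M _ (M.presheaf.map _ (m j))
    rw [unitSection_map, unitSection_map, hm i, hm j]
    change (((pullback f).obj M).presheaf.map ((Opens.map f.base).map (homOfLE i.2.1)).op ≫
        ((pullback f).obj M).presheaf.map ((Opens.map f.base).map (Opens.infLELeft (C i) (C j))).op) s =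
      (((pullback f).obj M).presheaf.map ((Opens.map f.base).map (homOfLE j.2.1)).op ≫
        ((pullback f).obj M).presheaf.map ((Opens.map f.base).map (Opens.infLERight (C i) (C j))).op) s
    rw [← Functor.map_comp, ← Functor.map_comp, ← op_comp, ← op_comp, ← Functor.map_comp, ← Functor.map_comp]
    exact congrArg (fun φ : C i ⊓ C j ⟶ W => ((pullback f).obj M).presheaf.map ((Opens.map f.base).map φ).op s)
      (Subsingleton.elim _ _)
  obtain ⟨glued, hglued, -⟩ := TopCat.Sheaf.existsUnique_gluing' (⟨M.presheaf, M.isSheaf⟩ : TopCat.Sheaf Ab Y) C W (fun j => homOfLE j.2.1) hcov m hcompat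
  refine ⟨glued, ?_⟩
  -- `η(glued) = s`, checked on the cover
  refine TopCat.Sheaf.eq_of_locally_eq' (⟨((pushforward f).obj ((pullback f).obj M)).presheaf, ((pushforward f).obj ((pullback f).obj M)).isSheaf⟩ : TopCat.Sheaf Ab Y) C W (fun j => homOfLE j.2.1) hcov
    ((pullbackUnit f M).app W glued) s fun j => ?_
  change ((pushforward f).obj ((pullback f).obj M)).presheaf.map (homOfLE j.2.1).op ((pullbackUnit f M).app W glued) = _
  rw [← app_presheaf_map (pullbackUnit f M) (homOfLE j.2.1) glued]
  change unitSection f M (C j) (M.presheaf.map (homOfLE j.2.1).op glued) = _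
  rw [show M.presheaf.map (homOfLE j.2.1).op glued = m j from hglued j, hm j]

end Literature.AlgebraicGeometry.Modules
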